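import Summits.HodgeConjecture.HodgeConjecture.Theorems.MilnorKExponentialSymbolClassesAlgebraicNashWeightTwoBand

/-!
# Line `NashDescentSketch`, stub (W₁-band): the typed globalisation hypothesis `hG` is implied by the stub it reduces

Crux `SymbolClassesAlgebraic` (stmt-HodgeConjecture-17743, route `MilnorKExponential`), line
`NashDescentSketch`, band stub (W₁-band) `stub_nashWeightTwoBandDiesOffClosed`. The landed
reduction `nashWeightTwoBandDiesOffClosed_of_globalisation` (p158038) derives the stub from a
GLOBALISATION hypothesis `hG` (open immersion `ι : U ⟶ X`, `U ≠ ∅`, finite étale surjective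
`φ : W ⟶ U`, and `(φ ≫ ι)^* c` in the `ℂ`-span of cup products `a ∪ (e₁ ∪ e₂)` with Kummer classes
`eᵢ` of global units of `W`) and Deligne's weight fact. This file proves the CONVERSE direction
without any fact: the conclusion of the stub implies `hG` as typed — take `U = X ∖ Z` (the open
subscheme on the complement of the proper closed `Z` off which `c` dies), `W = U`, `φ = 𝟙`; the
pulled-back class is `0`, which lies in every span. Hence, as TYPED, `hG` carries no content below
the stub (it is the stub modulo `deligne1971_weightKill_cupUnits`), and the stub itself is a
consequence of the crux (`Negative/LineCeiling.not_symbolClassesAlgebraic_of_not_nashWeightTwoBand`):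
the W₁ side of the line has no registered or typed statement strictly below the crux.

* `complexBetti_map_complOpen_eq_zero` — a class dying on `(X ∖ Z)(ℂ)` is killed by the pull-back
  to the open subscheme `X|_{X ∖ Z}` (the embedding `X|_{X∖Z}(ℂ) ↪ X(ℂ)` factors continuously
  through the subspace `(X ∖ Z)(ℂ)`); no new definitions (the open subscheme over `ℂ` is
  `Over.mk (V.ι ≫ X.hom)` with `Over.homMk V.ι`);
* `globalisation_of_dieOffClosed` — (W₁-band) ⇒ `hG` (verbatim the hypothesis of p158038).
-/

noncomputable section

open CategoryTheory AlgebraicGeometry Topology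
open Literature.AlgebraicTopology.SingularHomology

-- mandated namespace repeats `HodgeConjecture` (single-conjunct summit)
set_option linter.dupNamespace false

namespace Summit.HodgeConjecture.HodgeConjecture.Theorems.MilnorKExponentialNash

open Literature.AlgebraicGeometry Literature.AlgebraicGeometry.HodgeTheory
  Literature.AlgebraicGeometry.Motives

/-- **A class dying on `(X ∖ Z)(ℂ)` is killed by the pull-back to the open subscheme on `X ∖ Z`.**
The map on complex points of the open immersion `X|_{Zᶜ} ⟶ X` takes values in the subspace
`(X ∖ Z)(ℂ) = {P | P.pt ∉ Z}` (`AlgPoints.pt_map`, `Scheme.Opens.range_ι`), continuously, so the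
pull-back factors through the restriction map `complexBetti.restrictCompl X Z`. [folklore] -/
theorem complexBetti_map_complOpen_eq_zero {X : SchemeOver ℂ} {Z : Set X.left} (hZ : IsClosed Z)
    {i : ℕ} {c : complexBetti X i} (hc : complexBetti.restrictCompl X Z i c = 0) :
    complexBetti.map (Over.homMk (Scheme.Opens.ι (⟨Zᶜ, hZ.isOpen_compl⟩ : X.left.Opens)) rfl :
      Over.mk (Scheme.Opens.ι (⟨Zᶜ, hZ.isOpen_compl⟩ : X.left.Opens) ≫ X.hom) ⟶ X) i c = 0 := by
  set V : X.left.Opens := ⟨Zᶜ, hZ.isOpen_compl⟩ with hV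
  set UV : SchemeOver ℂ := Over.mk (V.ι ≫ X.hom) with hUV
  set ιV : UV ⟶ X := Over.homMk V.ι rfl with hιV
  have hmem : ∀ P : ComplexPoints UV, (AlgPoints.map ιV P).pt ∉ Z := by
    intro P
    have h1 : (AlgPoints.map ιV P).pt = V.ι.base P.pt := AlgPoints.pt_map _ _
    have h2 : V.ι.base P.pt ∈ (V : Set X.left) := by
      rw [← Scheme.Opens.range_ι V]
      exact ⟨P.pt, rfl⟩
    rw [h1]
    exact h2
  set g : C(ComplexPoints UV, complexPointsCompl X Z) :=
    ⟨fun P ↦ ⟨AlgPoints.map ιV P, hmem P⟩,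
      (AlgPoints.continuous_map _).subtype_mk _⟩ with hg
  have hfac : (⟨Subtype.val, continuous_subtype_val⟩ :
        C(complexPointsCompl X Z, ComplexPoints X)).comp g =
      AlgPoints.mapContinuous (L := ℂ) ιV := by
    ext P : 1
    rfl
  change singularCohomology.map ℂ ℂ (AlgPoints.mapContinuous (L := ℂ) ιV) i c = 0
  rw [← hfac, singularCohomology.map_comp, CategoryTheory.comp_apply]
  change singularCohomology.map ℂ ℂ g i (complexBetti.restrictCompl X Z i c) = 0
  rw [hc, map_zero]

/-- **(W₁-band) ⇒ the typed globalisation hypothesis `hG` of p158038.** If a rational Nash symbol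
class `c` of weight `2` dies off a proper closed `Z`, then the globalisation datum exists
trivially: `U = X|_{X ∖ Z}` (non-empty since `Z ≠ X`), `W = U`, `φ = 𝟙` (finite, étale,
surjective), and `(φ ≫ ι)^* c = ι^* c = 0 ∈ span {a ∪ (e₁ ∪ e₂)}`. So `hG` is not a statement
below the stub: modulo `deligne1971_weightKill_cupUnits` it IS the stub. [folklore] -/
theorem globalisation_of_dieOffClosed :
    (∀ ⦃n : ℕ⦄ ⦃X : SchemeOver ℂ⦄, IsSmoothProjective n X → 4 ≤ n →
      ∀ (c : complexBetti X (2 * (1 + 1))), IsRationalClass c → IsNashSymbolClass n X 1 c →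
        ∃ Z : Set X.left, IsClosed Z ∧ Z ≠ Set.univ ∧
          complexBetti.restrictCompl X Z (2 * (1 + 1)) c = 0) →
    ∀ ⦃n : ℕ⦄ ⦃X : SchemeOver ℂ⦄, IsSmoothProjective n X → 4 ≤ n →
      ∀ (c : complexBetti X (2 * (1 + 1))), IsRationalClass c → IsNashSymbolClass n X 1 c →
        ∃ (U W : SchemeOver ℂ) (ι : U ⟶ X) (φ : W ⟶ U),
          IsOpenImmersion ι.left ∧ Nonempty U.left ∧ IsFinite φ.left ∧ Etale φ.left ∧
          AlgebraicGeometry.Surjective φ.left ∧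
          complexBetti.map (φ ≫ ι) (2 * (1 + 1)) c ∈ Submodule.span ℂ
            {y : complexBetti W (2 * (1 + 1)) |
              ∃ (a : complexBetti W 2) (e₁ e₂ : complexBetti W 1),
                (∃ (u : Γ(W.left, ⊤)) (υ : C(ComplexPoints W, {z : ℂ // z ≠ 0}))
                    (γ : singularCohomology ℂ ℂ {z : ℂ // z ≠ 0} 1),
                  IsUnit u ∧ (∀ P, (υ P : ℂ) = AlgPoints.evalOrZero ⊤ u P) ∧
                    e₁ = singularCohomology.map ℂ ℂ υ 1 γ) ∧
                (∃ (u : Γ(W.left, ⊤)) (υ : C(ComplexPoints W, {z : ℂ // z ≠ 0}))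
                    (γ : singularCohomology ℂ ℂ {z : ℂ // z ≠ 0} 1),
                  IsUnit u ∧ (∀ P, (υ P : ℂ) = AlgPoints.evalOrZero ⊤ u P) ∧
                    e₂ = singularCohomology.map ℂ ℂ υ 1 γ) ∧
                y = cupProduct (rfl : 2 + 2 = 2 * (1 + 1)) a
                  (cupProduct (rfl : 1 + 1 = 2) e₁ e₂)} := by
  intro h n X hX hn c hc hs
  obtain ⟨Z, hZ, hZu, hres⟩ := h hX hn c hc hs
  obtain ⟨z, hz⟩ : (Zᶜ : Set X.left).Nonempty := Set.nonempty_compl.2 hZu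
  let V : X.left.Opens := ⟨Zᶜ, hZ.isOpen_compl⟩
  let UV : SchemeOver ℂ := Over.mk (V.ι ≫ X.hom)
  refine ⟨UV, UV, Over.homMk V.ι rfl, 𝟙 _, ?_, ⟨⟨z, hz⟩⟩, ?_, ?_, ?_, ?_⟩
  · change IsOpenImmersion V.ι
    infer_instance
  · change IsFinite (𝟙 UV.left)
    infer_instance
  · change Etale (𝟙 UV.left)
    infer_instance
  · change AlgebraicGeometry.Surjective (𝟙 UV.left)
    infer_instance
  · rw [Category.id_comp, complexBetti_map_complOpen_eq_zero hZ hres]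
    exact Submodule.zero_mem _

end Summit.HodgeConjecture.HodgeConjecture.Theorems.MilnorKExponentialNash

end
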